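import Summits.NavierStokesRegularity.FunctionalMining.NoGo.TopEigSaturatingKill

/-!
# FunctionalMining — the STATIC KILL CRITERION for the one-sided spectral rows, part 2:
# the `−λ₃` mirror (`ES.neglam3.q | T_LD`) and LEMMA K in large-viscosity form

Search for candidate a priori estimates; no regularity claim. Cell `pub-nsfunc`, no-go seat
(gen 30), staged as `pub-nsfunc-nogo/NoGo/TopEigSaturatingKill.STAGING.lean` v2 (sha256 122b2e12dd0fed58)
and filed by the prove seat (gen 24) in TWO parts for the 400-line lint: §§1–5 (integrable Danskin
densities, the compatible-selection inequality, the Euler strain tendency `eulerStrainVec`, heat-maximal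
selections, LEMMA S (ii), Lemma 0 (⇒) for `SaturatingLawSup`, the doors `TopEigSelKillAt` /
`TopEigSelKill`) in `NoGo/TopEigSaturatingKill.lean`; THIS file carries §§6–7, declarations
byte-identical to the staged file, same order. Refutation BOOKKEEPING for CANDIDATE a priori
inequalities; nothing about regularity.

* §6, the `−λ₃` MIRROR (rows `ES.neglam3.q`, `Ψ_q = ∫((−λ₃)⁺)^q`): `TopEig.integrable_negBotEigDensity`,
  `TopEig.neg_torusStrainBotEig_nonneg`, `TopEig.IsHeatMaxBotSelection` (unit top vectors of `−S(w)`
  maximising the heat form of `−S(Δw)`; `exists_isHeatMaxBotSelection`),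
  `TopEig.selEulerProductionBot q w e = ∫ q (−λ₃)^{q−1} eᵀ(−E_w)e`,
  `TopEig.selEulerProductionBot_sub_heat_le_integral` / `…_le_initialRate` (from
  `hasDerivWithinAt_negBotEigMoment_spaceTime`: the direction of `−S` along Navier–Stokes is
  `ν(−S(Δw)) + (−E_w)` — NOT the tendency of the datum `−w`, whose Euler part is again `E_w`),
  `SaturatingLawSup.selEulerProductionBot_sub_heat_le`, the doors `NegBotEigSelKillAt` /
  `NegBotEigSelKill` and `not_negBotEigMoment_saturatingLawSup_of_selKillAt` / `…_of_selKill`;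
* §7, **LEMMA K (large-viscosity form)**: `exists_nu_budget_lt_of_family` (elementary: `γ > 0`, a
  production floor `c > 0`, budgets in `[0, B]`, heat costs `≤ ε` for every `ε > 0` at some member ⇒
  for every real `κ` some `ν > 0` and some member satisfy `κ ν^{−γ} b < P − ν H`), hence
  **`topEigSelKill_of_family`** / **`negBotEigSelKill_of_family`** (an indexed family of admissible
  data and heat-maximal selections with (K-a) a production floor, (K-b) bounded budgets
  `(2ℰ w_i) Φ_q(w_i)^{1+1/σ} ≤ B`, (K-c) heat costs `heatDissipation Φ_q (w_i) ≤ ε` available for every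
  `ε > 0` gives `TopEigSelKill q σ γ`, resp. `NegBotEigSelKill q σ γ`, for every `γ > 0`) and
  **`not_topEigMoment_saturatingLawSup_of_family`** / **`not_negBotEigMoment_saturatingLawSup_of_family`**
  (`q ≥ 1`, `γ > 0`: such a family refutes `SaturatingLawSup Φ_q σ γ κ`, resp. `Ψ_q`, for EVERY `κ`;
  `SaturatingLawSup` quantifies over every `ν > 0`, so no amplitude scaling and no `q/σ` relation enter).

What is NOT here (pen, QN4-NOTE of the no-go seat; kernel WANTED): the transport identity LEMMA ADV,
the `ν`-wise pen LEMMA K, and the witness family W18 / `(F1)` itself — NO INSTANCE of `TopEigSelKill` /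
`NegBotEigSelKill` is proved here and no row verdict is a kernel theorem by this file.
[ours, bookkeeping; Danskin folklore]
-/

noncomputable section

open MeasureTheory Set Filter Topology

namespace Summit.NavierStokesRegularity.FunctionalMining

open Literature.Analysis.FunctionSpaces Literature.Analysis.FluidPDE

open TopEig

variable {d : Type*} [Fintype d] [DecidableEq d]

/-! ## 6. The mirror for the `−λ₃` rows `ES.neglam3.q | T_LD` (`Ψ_q = ∫((−λ₃)⁺)^q`) -/

namespace TopEig

open StrainL4 StrainTensor

variable [Nonempty d]

/-- The Danskin density of the `−λ₃` core, `x ↦ q (−λ₃)^{q−1} μ(−S(x); M(x))`, is integrable for smooth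
divergence-free `v`, `q ≥ 1` and every continuous direction field `M` (the `λ₁` statement at `−v`).
[ours] -/
theorem integrable_negBotEigDensity {q : ℝ} (hq : 1 ≤ q) {v : UnitAddTorus d → EuclideanSpace ℝ d}
    (hv : Torus.IsSmooth v) (hdv : Torus.IsDivFree v)
    {M : UnitAddTorus d → EuclideanSpace ℝ (d × d)} (hM : Continuous M) :
    Integrable (fun x => q * (-torusStrainBotEig v x) ^ (q - 1) *
      dirTopEig (-strainFlat v x) (M x)) volume := by
  have h := integrable_topEigDensity hq hv.neg ((torus_isDivFree_neg_iff v).2 hdv) hM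
  refine h.congr (ae_of_all _ fun x => ?_)
  simp only [torusStrainTopEig_neg, strainFlat_neg]

/-- `−λ₃ ≥ 0` pointwise for smooth divergence-free fields (`−λ₃(v) = λ₁(−v)`). [ours] -/
theorem neg_torusStrainBotEig_nonneg {v : UnitAddTorus d → EuclideanSpace ℝ d} (hv : Torus.IsSmooth v)
    (hdv : Torus.IsDivFree v) (x : UnitAddTorus d) : 0 ≤ -torusStrainBotEig v x := by
  rw [← torusStrainTopEig_neg, ← lam_strainFlat]
  exact lam_strainFlat_nonneg hv.neg ((torus_isDivFree_neg_iff v).2 hdv) x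

/-- **Heat-maximal bottom selection**: `e(x)` is a unit top vector of `−S(w)(x)` (a bottom eigenvector
of `S`) maximising the heat form of `−S(Δw)(x)` there. [ours, bookkeeping] -/
structure IsHeatMaxBotSelection (w : UnitAddTorus d → EuclideanSpace ℝ d)
    (e : UnitAddTorus d → d → ℝ) : Prop where
  top : ∀ x, e x ∈ topEigSet (-strainFlat w x)
  heat : ∀ x, quad (-strainFlat (Torus.laplacian w) x) (e x) =
    dirTopEig (-strainFlat w x) (-strainFlat (Torus.laplacian w) x)

/-- Heat-maximal bottom selections exist at every datum. [ours] -/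
theorem exists_isHeatMaxBotSelection (w : UnitAddTorus d → EuclideanSpace ℝ d) :
    ∃ e, IsHeatMaxBotSelection w e := by
  choose e he hq using fun x =>
    exists_quad_eq_dirTopEig (-strainFlat w x) (-strainFlat (Torus.laplacian w) x)
  exact ⟨e, ⟨he, hq⟩⟩

/-- **The Euler production of `Ψ_q` through a bottom selection**:
`𝒫̃_q(w; e) = ∫ q (−λ₃(x))^{q−1} e(x)ᵀ (−E_w(x)) e(x) dx`. Search for candidate a priori estimates; no
regularity claim — a static functional of the datum and the selection. [ours, bookkeeping] -/
def selEulerProductionBot (q : ℝ) (w : UnitAddTorus d → EuclideanSpace ℝ d)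
    (e : UnitAddTorus d → d → ℝ) : ℝ :=
  ∫ x, q * (-torusStrainBotEig w x) ^ (q - 1) * quad (-eulerStrainVec w x) (e x)

/-- **LEMMA S (ii) for `Ψ_q`, datum level**: for smooth divergence-free `w`, `q ≥ 1`, a heat-maximal
bottom selection `e` with integrable production density and every real `ν`:
`𝒫̃_q(w; e) − ν · heatDissipation Ψ_q w ≤ ∫ q (−λ₃)^{q−1} μ(−S(w); ν(−S(Δw)) + (−E_w))`. [ours] -/
theorem selEulerProductionBot_sub_heat_le_integral {q : ℝ} (hq : 1 ≤ q)
    {w : UnitAddTorus d → EuclideanSpace ℝ d} (hw : Torus.IsSmooth w) (hdw : Torus.IsDivFree w)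
    {e : UnitAddTorus d → d → ℝ} (he : IsHeatMaxBotSelection w e)
    (hint : Integrable (fun x => q * (-torusStrainBotEig w x) ^ (q - 1) *
      quad (-eulerStrainVec w x) (e x)) volume) (ν : ℝ) :
    selEulerProductionBot q w e - ν * heatDissipation (torusNegBotEigMoment q) w ≤
      ∫ x, q * (-torusStrainBotEig w x) ^ (q - 1) *
        dirTopEig (-strainFlat w x) (ν • (-strainFlat (Torus.laplacian w) x) + -eulerStrainVec w x) := by
  have hheat : Integrable (fun x => q * (-torusStrainBotEig w x) ^ (q - 1) *
      dirTopEig (-strainFlat w x) (-strainFlat (Torus.laplacian w) x)) volume :=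
    integrable_negBotEigDensity hq hw hdw (continuous_strainFlat hw.laplacian).neg
  have hrhs : Integrable (fun x => q * (-torusStrainBotEig w x) ^ (q - 1) *
      dirTopEig (-strainFlat w x) (ν • (-strainFlat (Torus.laplacian w) x) + -eulerStrainVec w x))
      volume :=
    integrable_negBotEigDensity hq hw hdw
      (((continuous_strainFlat hw.laplacian).neg.const_smul ν).add (continuous_eulerStrainVec hw).neg)
  rw [heatDissipation_negBotEigMoment_eq_integral hq hw hdw, selEulerProductionBot, mul_neg,
    sub_neg_eq_add, ← integral_const_mul, ← integral_add hint (hheat.const_mul ν)]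
  refine integral_mono (hint.add (hheat.const_mul ν)) hrhs fun x => ?_
  have hc : 0 ≤ q * (-torusStrainBotEig w x) ^ (q - 1) :=
    mul_nonneg (by linarith) (Real.rpow_nonneg (neg_torusStrainBotEig_nonneg hw hdw x) _)
  have hpt := dirTopEig_smul_add_ge (X := -eulerStrainVec w x) (he.top x) (he.heat x) ν
  calc q * (-torusStrainBotEig w x) ^ (q - 1) * quad (-eulerStrainVec w x) (e x) +
        ν * (q * (-torusStrainBotEig w x) ^ (q - 1) *
          dirTopEig (-strainFlat w x) (-strainFlat (Torus.laplacian w) x))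
        = q * (-torusStrainBotEig w x) ^ (q - 1) *
          (ν * dirTopEig (-strainFlat w x) (-strainFlat (Torus.laplacian w) x) +
            quad (-eulerStrainVec w x) (e x)) := by ring
    _ ≤ q * (-torusStrainBotEig w x) ^ (q - 1) *
          dirTopEig (-strainFlat w x) (ν • (-strainFlat (Torus.laplacian w) x) + -eulerStrainVec w x) :=
        mul_le_mul_of_nonneg_left hpt hc

/-- **LEMMA S (i)+(ii) for `Ψ_q` along Navier–Stokes.** Along a classical unforced solution on
`T^d × [a, b]`, `a < b`, `q ≥ 1`, with a heat-maximal bottom selection `e` for the slice `u a` whose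
production density is integrable: `s ↦ Ψ_q(u s)` has at `s = a` the right derivative value
`R = ∫ q (−λ₃)^{q−1} μ(−S(u a); ν(−S(Δ u a)) + (−E_{u a}))` within `[a, b]`
(`hasDerivWithinAt_negBotEigMoment_spaceTime` and the strain equation), and
`𝒫̃_q(u a; e) − ν · heatDissipation Ψ_q (u a) ≤ R`. [ours; QN4-NOTE LEMMA S, `−λ₃` mirror] -/
theorem selEulerProductionBot_sub_heat_le_initialRate {q : ℝ} (hq : 1 ≤ q) {a b ν : ℝ} (hab : a < b)
    {u : ℝ → UnitAddTorus d → EuclideanSpace ℝ d} {p : ℝ → UnitAddTorus d → ℝ}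
    (h : Torus.IsClassicalNSSolutionOn (Icc a b) ν 0 u p)
    {e : UnitAddTorus d → d → ℝ} (he : IsHeatMaxBotSelection (u a) e)
    (hint : Integrable (fun x => q * (-torusStrainBotEig (u a) x) ^ (q - 1) *
      quad (-eulerStrainVec (u a) x) (e x)) volume) :
    ∃ R : ℝ, HasDerivWithinAt (fun s => torusNegBotEigMoment q (u s)) R (Icc a b) a ∧
      selEulerProductionBot q (u a) e - ν * heatDissipation (torusNegBotEigMoment q) (u a) ≤ R := by
  have ha : a ∈ Icc a b := left_mem_Icc.2 hab.le
  have hw : Torus.IsSmooth (u a) := h.smooth_velocity.isSmooth_slice ha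
  have hdw : Torus.IsDivFree (u a) := h.divFree a ha
  have hP : ∀ x, pressVec (p a) x = pressVec (pressureOf (u a)) x := fun x => by
    rw [pressureOf_eq_pressure_sub_integral h hab ha, pressVec_sub_const]
  have hdir : ∀ x, -Torus.timeDerivWithin (Icc a b) (fun s y => strainFlat (u s) y) a x =
      ν • (-strainFlat (Torus.laplacian (u a)) x) + -eulerStrainVec (u a) x := fun x => by
    rw [StrainTensor.timeDerivWithin_strainFlat_eq h hab ha x, ← strainFlat_laplacian hw x, hP x,
      Pi.zero_apply, strainFlat_zero, eulerStrainVec, smul_neg]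
    abel
  have h1 := hasDerivWithinAt_negBotEigMoment_spaceTime hab h.smooth_velocity h.divFree hq
    ⟨le_rfl, hab⟩
  refine ⟨_, ((hasDerivWithinAt_Ioi_iff_Ici.1 (h1.congr_deriv
    (integral_congr_ae (ae_of_all _ fun x => by simp only [hdir x])))).mono Icc_subset_Ici_self),
    selEulerProductionBot_sub_heat_le_integral hq hw hdw he hint ν⟩

end TopEig

/-- **The static necessary condition for the `−λ₃` rows.** Under `SaturatingLawSup Ψ_q σ γ κ` on `T³`
(`q ≥ 1`): at every smooth divergence-free zero-mean datum `w`, every heat-maximal bottom selection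
`e` with integrable production density and every `ν > 0`,
`𝒫̃_q(w; e) − ν · heatDissipation Ψ_q w ≤ κ ν^{−γ} (2ℰ w) Ψ_q(w)^{1+1/σ}`. [ours] -/
theorem SaturatingLawSup.selEulerProductionBot_sub_heat_le {q σ γ κ : ℝ} (hq : 1 ≤ q)
    (hd : Fintype.card d = 3)
    (h : SaturatingLawSup (d := d) (torusNegBotEigMoment q) σ γ κ) {ν : ℝ} (hν : 0 < ν)
    {w : UnitAddTorus d → EuclideanSpace ℝ d} (hw : Torus.IsSmooth w) (hdw : Torus.IsDivFree w)
    (hmean : Torus.HasZeroMean w) {e : UnitAddTorus d → d → ℝ} (he : IsHeatMaxBotSelection w e)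
    (hint : Integrable (fun x => q * (-torusStrainBotEig w x) ^ (q - 1) *
      quad (-eulerStrainVec w x) (e x)) volume) :
    selEulerProductionBot q w e - ν * heatDissipation (torusNegBotEigMoment q) w ≤
      κ * ν ^ (-γ) * (2 * torusEnstrophy w) * torusNegBotEigMoment q w ^ (1 + σ⁻¹) := by
  haveI : Nonempty d := Fintype.card_pos_iff.1 (by omega)
  refine h.lowerRate_le hd hν hw hdw hmean fun T hT u p hsol hu0 _ => ?_
  subst hu0
  exact selEulerProductionBot_sub_heat_le_initialRate hq hT hsol he hint

/-- **The static door at one constant** (`−λ₃` rows): ONE `ν > 0`, ONE smooth divergence-free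
zero-mean datum `w` on `T³` and ONE heat-maximal bottom selection `e` (integrable production density)
with `κ ν^{−γ} (2ℰ w) Ψ_q(w)^{1+1/σ} < 𝒫̃_q(w; e) − ν · heatDissipation Ψ_q w`. Nothing is asserted.
[ours, bookkeeping] -/
def NegBotEigSelKillAt (q σ γ κ : ℝ) : Prop :=
  ∃ ν : ℝ, 0 < ν ∧ ∃ w : UnitAddTorus (Fin 3) → EuclideanSpace ℝ (Fin 3),
    Torus.IsSmooth w ∧ Torus.IsDivFree w ∧ Torus.HasZeroMean w ∧
    ∃ e : UnitAddTorus (Fin 3) → Fin 3 → ℝ, IsHeatMaxBotSelection w e ∧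
      Integrable (fun x => q * (-torusStrainBotEig w x) ^ (q - 1) *
        quad (-eulerStrainVec w x) (e x)) volume ∧
      κ * ν ^ (-γ) * (2 * torusEnstrophy w) * torusNegBotEigMoment q w ^ (1 + σ⁻¹) <
        selEulerProductionBot q w e - ν * heatDissipation (torusNegBotEigMoment q) w

/-- **The static door for every constant** (`−λ₃` rows). Nothing is asserted. [ours, bookkeeping] -/
def NegBotEigSelKill (q σ γ : ℝ) : Prop :=
  ∀ κ : ℝ, NegBotEigSelKillAt q σ γ κ

/-- **Door ⇒ kill at one constant** (`−λ₃` rows): `NegBotEigSelKillAt q σ γ κ →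
¬ SaturatingLawSup Ψ_q σ γ κ` on `T³` (`q ≥ 1`). Refutation bookkeeping for a CANDIDATE inequality;
nothing about regularity. [ours] -/
theorem not_negBotEigMoment_saturatingLawSup_of_selKillAt {q σ γ κ : ℝ} (hq : 1 ≤ q)
    (hK : NegBotEigSelKillAt q σ γ κ) :
    ¬ SaturatingLawSup (d := Fin 3) (torusNegBotEigMoment q) σ γ κ := by
  intro hlaw
  obtain ⟨ν, hν, w, hw, hdw, hmean, e, he, hint, hlt⟩ := hK
  exact (not_le.2 hlt) (hlaw.selEulerProductionBot_sub_heat_le hq (by simp) hν hw hdw hmean he hint)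

/-- **Door ⇒ kill for every constant** (`−λ₃` rows): `NegBotEigSelKill q σ γ →
∀ κ, ¬ SaturatingLawSup Ψ_q σ γ κ` on `T³` (`q ≥ 1`). [ours] -/
theorem not_negBotEigMoment_saturatingLawSup_of_selKill {q σ γ : ℝ} (hq : 1 ≤ q)
    (hK : NegBotEigSelKill q σ γ) (κ : ℝ) :
    ¬ SaturatingLawSup (d := Fin 3) (torusNegBotEigMoment q) σ γ κ :=
  not_negBotEigMoment_saturatingLawSup_of_selKillAt hq (hK κ)

/-! ## 7. LEMMA K, large-viscosity form: a family opens the door for every constant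

`SaturatingLawSup F σ γ κ` quantifies over EVERY viscosity `ν > 0`, so ONE `ν` refutes it. For
`γ > 0` the budget `κ ν^{−γ} (2ℰ w) F(w)^{1+1/σ}` of a member of a family with BOUNDED budgets is
small once `ν` is large, and the heat cost `ν · heatDissipation F w` is then kept below a quarter of
the production floor by choosing the member AFTER `ν` (heat costs `≤ ε` are available for every
`ε > 0`). No amplitude scaling and no relation between `q` and `σ` enter. Search for candidate a
priori estimates; no regularity claim — elementary real analysis on top of §§5–6; no family is
exhibited here (the pen family is W18 / `(F1)` of the no-go seat). -/

section LemmaK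

variable {ι : Type*}

/-- **LEMMA K, arithmetic core.** `γ > 0`; a floor `c > 0` with `c ≤ P i`; budgets `0 ≤ b i ≤ B`;
heat costs with `H i ≤ ε` available for every `ε > 0`. Then for every real `κ` there are `ν > 0` and a
member `i` with `κ ν^{−γ} b i < P i − ν H i` (take `ν` with `ν^{−γ} = c / (4(|κ|B + 1))`, then `i`
with `H i ≤ c/(4ν)`). [ours, bookkeeping; elementary] -/
theorem exists_nu_budget_lt_of_family {γ c B : ℝ} (hγ : 0 < γ) (hc : 0 < c) {b P H : ι → ℝ}
    (hb0 : ∀ i, 0 ≤ b i) (hbB : ∀ i, b i ≤ B) (hP : ∀ i, c ≤ P i)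
    (hH : ∀ ε : ℝ, 0 < ε → ∃ i, H i ≤ ε) (κ : ℝ) :
    ∃ ν : ℝ, 0 < ν ∧ ∃ i, κ * ν ^ (-γ) * b i < P i - ν * H i := by
  obtain ⟨i₀, -⟩ := hH 1 one_pos
  have hA0 : 0 ≤ |κ| * B := mul_nonneg (abs_nonneg κ) ((hb0 i₀).trans (hbB i₀))
  have hA1 : 0 < 4 * (|κ| * B + 1) := by linarith
  obtain ⟨δ, hδ0, hδeq⟩ : ∃ δ : ℝ, 0 < δ ∧ δ * (4 * (|κ| * B + 1)) = c :=
    ⟨c / (4 * (|κ| * B + 1)), div_pos hc hA1, div_mul_cancel₀ c hA1.ne'⟩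
  obtain ⟨ν, hν0, hνγ⟩ : ∃ ν : ℝ, 0 < ν ∧ ν ^ (-γ) = δ :=
    ⟨δ ^ (-γ)⁻¹, Real.rpow_pos_of_pos hδ0 _, Real.rpow_inv_rpow hδ0.le (neg_ne_zero.2 hγ.ne')⟩
  obtain ⟨i, hi⟩ := hH (c / 4 / ν) (div_pos (by linarith) hν0)
  refine ⟨ν, hν0, i, ?_⟩
  have h1 : κ * ν ^ (-γ) * b i ≤ |κ| * B * δ := by
    rw [hνγ]
    calc κ * δ * b i ≤ |κ| * δ * b i :=
          mul_le_mul_of_nonneg_right (mul_le_mul_of_nonneg_right (le_abs_self κ) hδ0.le) (hb0 i)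
      _ ≤ |κ| * δ * B := mul_le_mul_of_nonneg_left (hbB i) (mul_nonneg (abs_nonneg κ) hδ0.le)
      _ = |κ| * B * δ := by ring
  have h2 : |κ| * B * δ = c / 4 - δ := by linear_combination hδeq / 4
  have h3 : ν * H i ≤ c / 4 :=
    calc ν * H i ≤ ν * (c / 4 / ν) := mul_le_mul_of_nonneg_left hi hν0.le
      _ = c / 4 := mul_div_cancel₀ _ hν0.ne'
  linarith [hP i]

/-- **LEMMA K for the `λ₁` rows (large-viscosity form).** `γ > 0`; an indexed family of smooth
divergence-free zero-mean data `w i` on `T³` with heat-maximal selections `e i` (integrable production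
densities), (K-a) a production floor `0 < c ≤ 𝒫_q(w i; e i)`, (K-b) bounded budgets
`(2ℰ (w i)) Φ_q(w i)^{1+1/σ} ≤ B`, (K-c) heat costs `heatDissipation Φ_q (w i) ≤ ε` available for
every `ε > 0`: then `TopEigSelKill q σ γ`. Search for candidate a priori estimates; no regularity
claim — the hypotheses (K-a)–(K-c) are what a pen witness family must supply; none is exhibited.
[ours; QN4-NOTE LEMMA K, large-viscosity form] -/
theorem topEigSelKill_of_family {q σ γ c B : ℝ} (hγ : 0 < γ) (hc : 0 < c)
    {w : ι → UnitAddTorus (Fin 3) → EuclideanSpace ℝ (Fin 3)} {e : ι → UnitAddTorus (Fin 3) → Fin 3 → ℝ}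
    (hw : ∀ i, Torus.IsSmooth (w i)) (hdw : ∀ i, Torus.IsDivFree (w i))
    (hmean : ∀ i, Torus.HasZeroMean (w i)) (he : ∀ i, IsHeatMaxSelection (w i) (e i))
    (hint : ∀ i, Integrable (fun x => q * torusStrainTopEig (w i) x ^ (q - 1) *
      quad (eulerStrainVec (w i) x) (e i x)) volume)
    (hprod : ∀ i, c ≤ selEulerProduction q (w i) (e i))
    (hbud : ∀ i, 2 * torusEnstrophy (w i) * torusTopEigMoment q (w i) ^ (1 + σ⁻¹) ≤ B)
    (hheat : ∀ ε : ℝ, 0 < ε → ∃ i, heatDissipation (torusTopEigMoment q) (w i) ≤ ε) :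
    TopEigSelKill q σ γ := by
  intro κ
  obtain ⟨ν, hν, i, hlt⟩ := exists_nu_budget_lt_of_family hγ hc
    (b := fun i => 2 * torusEnstrophy (w i) * torusTopEigMoment q (w i) ^ (1 + σ⁻¹))
    (P := fun i => selEulerProduction q (w i) (e i))
    (H := fun i => heatDissipation (torusTopEigMoment q) (w i))
    (fun i => mul_nonneg (mul_nonneg two_pos.le (torusEnstrophy_nonneg _))
      (Real.rpow_nonneg (torusTopEigMoment_nonneg q _) _)) hbud hprod hheat κ
  refine ⟨ν, hν, w i, hw i, hdw i, hmean i, e i, he i, hint i, ?_⟩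
  have h' : κ * ν ^ (-γ) * (2 * torusEnstrophy (w i)) * torusTopEigMoment q (w i) ^ (1 + σ⁻¹) =
      κ * ν ^ (-γ) * (2 * torusEnstrophy (w i) * torusTopEigMoment q (w i) ^ (1 + σ⁻¹)) := by ring
  rw [h']
  exact hlt

/-- **A family kills the `λ₁` law for every constant**: under the hypotheses of
`topEigSelKill_of_family` and `q ≥ 1`, `¬ SaturatingLawSup Φ_q σ γ κ` on `T³` for EVERY real `κ`.
Refutation bookkeeping for a CANDIDATE inequality; nothing about regularity; no family exhibited.
[ours] -/
theorem not_topEigMoment_saturatingLawSup_of_family {q σ γ c B : ℝ} (hq : 1 ≤ q) (hγ : 0 < γ)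
    (hc : 0 < c)
    {w : ι → UnitAddTorus (Fin 3) → EuclideanSpace ℝ (Fin 3)} {e : ι → UnitAddTorus (Fin 3) → Fin 3 → ℝ}
    (hw : ∀ i, Torus.IsSmooth (w i)) (hdw : ∀ i, Torus.IsDivFree (w i))
    (hmean : ∀ i, Torus.HasZeroMean (w i)) (he : ∀ i, IsHeatMaxSelection (w i) (e i))
    (hint : ∀ i, Integrable (fun x => q * torusStrainTopEig (w i) x ^ (q - 1) *
      quad (eulerStrainVec (w i) x) (e i x)) volume)
    (hprod : ∀ i, c ≤ selEulerProduction q (w i) (e i))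
    (hbud : ∀ i, 2 * torusEnstrophy (w i) * torusTopEigMoment q (w i) ^ (1 + σ⁻¹) ≤ B)
    (hheat : ∀ ε : ℝ, 0 < ε → ∃ i, heatDissipation (torusTopEigMoment q) (w i) ≤ ε) (κ : ℝ) :
    ¬ SaturatingLawSup (d := Fin 3) (torusTopEigMoment q) σ γ κ :=
  not_topEigMoment_saturatingLawSup_of_selKill hq
    (topEigSelKill_of_family hγ hc hw hdw hmean he hint hprod hbud hheat) κ

/-- **LEMMA K for the `−λ₃` rows (large-viscosity form).** As `topEigSelKill_of_family` with
heat-maximal bottom selections, the production `𝒫̃_q`, the weight `Ψ_q` and its heat dissipation: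
(K-a)–(K-c) give `NegBotEigSelKill q σ γ` for every `γ > 0`. Nothing is exhibited. [ours] -/
theorem negBotEigSelKill_of_family {q σ γ c B : ℝ} (hγ : 0 < γ) (hc : 0 < c)
    {w : ι → UnitAddTorus (Fin 3) → EuclideanSpace ℝ (Fin 3)} {e : ι → UnitAddTorus (Fin 3) → Fin 3 → ℝ}
    (hw : ∀ i, Torus.IsSmooth (w i)) (hdw : ∀ i, Torus.IsDivFree (w i))
    (hmean : ∀ i, Torus.HasZeroMean (w i)) (he : ∀ i, IsHeatMaxBotSelection (w i) (e i))
    (hint : ∀ i, Integrable (fun x => q * (-torusStrainBotEig (w i) x) ^ (q - 1) *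
      quad (-eulerStrainVec (w i) x) (e i x)) volume)
    (hprod : ∀ i, c ≤ selEulerProductionBot q (w i) (e i))
    (hbud : ∀ i, 2 * torusEnstrophy (w i) * torusNegBotEigMoment q (w i) ^ (1 + σ⁻¹) ≤ B)
    (hheat : ∀ ε : ℝ, 0 < ε → ∃ i, heatDissipation (torusNegBotEigMoment q) (w i) ≤ ε) :
    NegBotEigSelKill q σ γ := by
  intro κ
  obtain ⟨ν, hν, i, hlt⟩ := exists_nu_budget_lt_of_family hγ hc
    (b := fun i => 2 * torusEnstrophy (w i) * torusNegBotEigMoment q (w i) ^ (1 + σ⁻¹))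
    (P := fun i => selEulerProductionBot q (w i) (e i))
    (H := fun i => heatDissipation (torusNegBotEigMoment q) (w i))
    (fun i => mul_nonneg (mul_nonneg two_pos.le (torusEnstrophy_nonneg _))
      (Real.rpow_nonneg (torusNegBotEigMoment_nonneg q _) _)) hbud hprod hheat κ
  refine ⟨ν, hν, w i, hw i, hdw i, hmean i, e i, he i, hint i, ?_⟩
  have h' : κ * ν ^ (-γ) * (2 * torusEnstrophy (w i)) * torusNegBotEigMoment q (w i) ^ (1 + σ⁻¹) =
      κ * ν ^ (-γ) * (2 * torusEnstrophy (w i) * torusNegBotEigMoment q (w i) ^ (1 + σ⁻¹)) := by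
    ring
  rw [h']
  exact hlt

/-- **A family kills the `−λ₃` law for every constant**: under the hypotheses of
`negBotEigSelKill_of_family` and `q ≥ 1`, `¬ SaturatingLawSup Ψ_q σ γ κ` on `T³` for EVERY real
`κ`. Refutation bookkeeping for a CANDIDATE inequality; nothing about regularity. [ours] -/
theorem not_negBotEigMoment_saturatingLawSup_of_family {q σ γ c B : ℝ} (hq : 1 ≤ q) (hγ : 0 < γ)
    (hc : 0 < c)
    {w : ι → UnitAddTorus (Fin 3) → EuclideanSpace ℝ (Fin 3)} {e : ι → UnitAddTorus (Fin 3) → Fin 3 → ℝ}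
    (hw : ∀ i, Torus.IsSmooth (w i)) (hdw : ∀ i, Torus.IsDivFree (w i))
    (hmean : ∀ i, Torus.HasZeroMean (w i)) (he : ∀ i, IsHeatMaxBotSelection (w i) (e i))
    (hint : ∀ i, Integrable (fun x => q * (-torusStrainBotEig (w i) x) ^ (q - 1) *
      quad (-eulerStrainVec (w i) x) (e i x)) volume)
    (hprod : ∀ i, c ≤ selEulerProductionBot q (w i) (e i))
    (hbud : ∀ i, 2 * torusEnstrophy (w i) * torusNegBotEigMoment q (w i) ^ (1 + σ⁻¹) ≤ B)
    (hheat : ∀ ε : ℝ, 0 < ε → ∃ i, heatDissipation (torusNegBotEigMoment q) (w i) ≤ ε) (κ : ℝ) :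
    ¬ SaturatingLawSup (d := Fin 3) (torusNegBotEigMoment q) σ γ κ :=
  not_negBotEigMoment_saturatingLawSup_of_selKill hq
    (negBotEigSelKill_of_family hγ hc hw hdw hmean he hint hprod hbud hheat) κ

end LemmaK

end Summit.NavierStokesRegularity.FunctionalMining

end
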